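import Literature.Computability.AlgebraicComplexity.IK2020TableauLiftingOddLeftPart
import Literature.Computability.AlgebraicComplexity.IK2020TableauLiftingEven
import HarnessLib

/-!
# Ikenmeyer–Kandasamy 2020, Thm. 13.1 (Tableau Lifting Theorem) for odd `D`, and the theorem

References: C. Ikenmeyer, U. Kandasamy, "Implementing geometric complexity theory: on the
separation of orbit closures via symmetries", STOC 2020 / arXiv:1911.03990 (bib key
`IkenmeyerKandasamy2019`), Thm. 13.1 (TeX L1128–1144; chunk p0019.txt:L11–26 of the held text
`paper:arxiv-1911.03990`) and its proof for odd `D`, §§18–21 (TeX L2410–3560; chunks p0027–p0033).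

Brick O2 — the LAST brick — of the multi-seat program for the named fact `IK2020_thm_13_1`
(`AC/IK20HighestWeightVectors.lean`; route note `HOME/bip/NOTE-t08g4-IK2020Thm131-route.md`):
the hypergraph data for odd `D` (Prop. 18.3's paired chains, the bridges, the `barred` patterns of
§19) packaged as an `IK2020.OddLinkData` (brick O1), the assembly of a lifting witness, Thm. 13.1
for odd `D`, and — with the even half `IK2020_thm_13_1_even` (brick E4) — the DISCHARGE
`IK2020_thm_13_1_holds`. Definitions with bodies (the concrete pairing, labels and bridges) and
proved theorems; no named fact; net debt −1. Honest framing: `IK2020_thm_13_1` is a combinatorial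
theorem used inside IK's proof of their Thm. 4.2 (`IK2020_thm_4_2`, still a named fact); VP ≠ VNP
is NOT proved and nothing here is progress on it.

## Contents

* §A the `barred` patterns (§19, eq. (19.4) 'eq:bridgebar', TeX L3047–3055: "choose a set of
  `m - 1` many distinct cardinality `D` subsets … one of the two bridge vertices is contained in all
  …, the other … in none"; their number `C(2D-2, D-1)` is where the hypothesis
  `C(2(D-1), D-1) ≥ 2(m-1)` of Thm. 13.1 enters): an injective family of `m` such subsets of
  `Fin 2 × Fin D` (`exists_patterns`).
* §B the concrete pairing `k ↦ k̄` (`2p ↔ 2p+1`, as in the proof of Prop. 18.3 /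
  `IK2020.Chain.isDKPaired_hyper`), the labels `kbar(i,j,v)` built from a pattern, the bridge
  vertices `(2p, D-1) ~ (2p+1, 0)` (the size-2 name edges of the chain), with their counting
  properties (`OddChain.*`).
* §C the name-edge index of the chain hypergraph with its constancy on name edges
  (`exists_linkFun_chain₂`, as E4's `exists_linkFun_chain`), the data of one letter for odd `D`
  (`exists_oddLinkFun`) and of all letters (`nonempty_oddLinkData`).
* §D assembly (`OddLinkData.exists_liftingWitness`), **Thm. 13.1 for odd `D`**
  (`IK2020_thm_13_1_odd`) and **`IK2020_thm_13_1_holds`**.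
-/

namespace Literature.Computability.AlgebraicComplexity

namespace IK2020

open Finset

/-! ## §A  The `barred` patterns -/

/-- **The patterns of the sets `barred(i,j,k)`** (§19, TeX L3047–3055): `m` pairwise different
`D`-element subsets of the `2D` positions `Fin 2 × Fin D` of a pair of block edges, each containing
the bridge position `(1, 0)` and avoiding the bridge position `(0, D-1)`; they exist as soon as
`m ≤ C(2D-2, D-1)` (choose `D - 1` further positions among the `2D - 2` non-bridge ones).
[cite: IkenmeyerKandasamy2019, §19] -/
theorem exists_patterns {D m : ℕ} (hD : 2 ≤ D) (hm : m ≤ Nat.choose (2 * D - 2) (D - 1)) :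
    ∃ pat : Fin m → Finset (Fin 2 × Fin D), Function.Injective pat ∧
      ∀ j, (pat j).card = D ∧ ((1, ⟨0, by omega⟩) : Fin 2 × Fin D) ∈ pat j ∧
        ((0, ⟨D - 1, by omega⟩) : Fin 2 × Fin D) ∉ pat j := by
  classical
  set p₁ : Fin 2 × Fin D := (1, ⟨0, by omega⟩) with hp₁
  set p₀ : Fin 2 × Fin D := (0, ⟨D - 1, by omega⟩) with hp₀
  have hne : p₁ ≠ p₀ := by
    intro h
    have := congrArg Prod.fst h
    simp [hp₁, hp₀] at this
  set base : Finset (Fin 2 × Fin D) := univ \ {p₁, p₀} with hbase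
  have hcb : base.card = 2 * D - 2 := by
    rw [hbase, Finset.card_sdiff_of_subset (Finset.subset_univ _), Finset.card_univ,
      Fintype.card_prod, Fintype.card_fin, Fintype.card_fin, Finset.card_pair hne]
  set T := base.powersetCard (D - 1) with hT
  have hcT : Fintype.card ↥T = Nat.choose (2 * D - 2) (D - 1) := by
    rw [Fintype.card_coe, hT, Finset.card_powersetCard, hcb]
  obtain ⟨emb⟩ := Function.Embedding.nonempty_of_card_le (α := Fin m) (β := ↥T)
    (by rw [Fintype.card_fin, hcT]; exact hm)
  have hmemT : ∀ j, (emb j).1 ⊆ base ∧ ((emb j).1).card = D - 1 := fun j =>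
    Finset.mem_powersetCard.mp (emb j).2
  have hp₁not : ∀ j, p₁ ∉ (emb j).1 := fun j h => by
    have := (hmemT j).1 h
    rw [hbase, Finset.mem_sdiff] at this
    exact this.2 (Finset.mem_insert_self _ _)
  refine ⟨fun j => insert p₁ (emb j).1, fun j j' h => ?_, fun j => ⟨?_, Finset.mem_insert_self _ _, ?_⟩⟩
  · have h' : (emb j).1 = (emb j').1 := by
      rw [← Finset.erase_insert (hp₁not j), ← Finset.erase_insert (hp₁not j')]
      exact congrArg (fun s => Finset.erase s p₁) h
    exact emb.injective (Subtype.ext h')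
  · rw [Finset.card_insert_of_notMem (hp₁not j), (hmemT j).2]
    omega
  · rw [Finset.mem_insert, not_or]
    refine ⟨hne.symm, fun h => ?_⟩
    have := (hmemT j).1 h
    rw [hbase, Finset.mem_sdiff] at this
    exact this.2 (Finset.mem_insert_of_mem (Finset.mem_singleton_self _))

/-! ## §B  The concrete pairing, labels and bridges on `Fin N × Fin D`, `N` even -/

namespace OddChain

/-- The partner index `2p ↔ 2p+1` (proof of Prop. 18.3: consecutive block edges are paired).
[cite: IkenmeyerKandasamy2019, Prop. 18.3] -/
def pairIdx (k : ℕ) : ℕ :=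
  if k % 2 = 0 then k + 1 else k - 1

/-- [cite: IkenmeyerKandasamy2019, Prop. 18.3] -/
theorem pairIdx_lt {N k : ℕ} (hN : Even N) (hk : k < N) : pairIdx k < N := by
  obtain ⟨t, rfl⟩ := hN
  unfold pairIdx
  split_ifs <;> omega

/-- [cite: IkenmeyerKandasamy2019, Prop. 18.3] -/
theorem pairIdx_ne (k : ℕ) : pairIdx k ≠ k := by
  unfold pairIdx
  split_ifs <;> omega

/-- [cite: IkenmeyerKandasamy2019, Prop. 18.3] -/
theorem pairIdx_pairIdx (k : ℕ) : pairIdx (pairIdx k) = k := by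
  unfold pairIdx
  split_ifs <;> omega

/-- [cite: IkenmeyerKandasamy2019, Prop. 18.3] -/
theorem pairIdx_eq (k : ℕ) : pairIdx k = 2 * (k / 2) + (1 - k % 2) := by
  unfold pairIdx
  split_ifs <;> omega

/-- In an even number of block edges every `2(k/2) + 1` is still a block edge.
[cite: IkenmeyerKandasamy2019, Prop. 18.3] -/
theorem two_mul_div_add_one_lt {N k : ℕ} (hN : Even N) (hk : k < N) : 2 * (k / 2) + 1 < N := by
  obtain ⟨t, rfl⟩ := hN
  omega

variable {N D : ℕ}

/-- The partner block edge `k̄`. [cite: IkenmeyerKandasamy2019, Def. 18.1] -/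
def kbar (hN : Even N) (k : Fin N) : Fin N :=
  ⟨pairIdx k.val, pairIdx_lt hN k.isLt⟩

/-- The parity of a block edge: its position (unbarred `0` / barred `1`) in its pair.
[cite: IkenmeyerKandasamy2019, §19] -/
def par (k : Fin N) : Fin 2 :=
  ⟨k.val % 2, Nat.mod_lt _ two_pos⟩

/-- **The label `kbar(i,j,v)`** of the vertex `v = (k, s)` built from the pattern `pat = ` (positions
of) `barred(i,j,k(v))`: the barred member `2(k/2)+1` of the pair if the position `(k mod 2, s)` is in
the pattern, the unbarred member `2(k/2)` otherwise (§19: "`kbar(i,j,v) := k̄(v)` if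
`v ∈ barred(i,j,k(v))`, `k(v)` otherwise"). [cite: IkenmeyerKandasamy2019, §19] -/
def label (hN : Even N) (pat : Finset (Fin 2 × Fin D)) (v : Fin N × Fin D) : Fin N :=
  ⟨2 * (v.1.val / 2) + (if (par v.1, v.2) ∈ pat then 1 else 0), by
    have := two_mul_div_add_one_lt hN v.1.isLt
    split_ifs <;> omega⟩

/-- **The bridge vertex** of the block edge `k`: its last vertex `(k, D-1)` if `k` is the first
block edge of its pair, its first vertex `(k, 0)` otherwise (proof of Prop. 18.3: "the rightmost
vertex of every odd block edge and the leftmost vertex of every even block edge are bridge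
vertices"). [cite: IkenmeyerKandasamy2019, Prop. 18.3] -/
def brg (hD : 1 ≤ D) (k : Fin N) : Fin N × Fin D :=
  (k, if k.val % 2 = 0 then ⟨D - 1, by omega⟩ else ⟨0, by omega⟩)

/-- `k̄ ≠ k`. [cite: IkenmeyerKandasamy2019, Def. 18.1] -/
theorem kbar_ne (hN : Even N) (k : Fin N) : kbar hN k ≠ k := by
  intro h
  exact pairIdx_ne k.val (congrArg Fin.val h)

/-- `k̄̄ = k`. [cite: IkenmeyerKandasamy2019, Def. 18.1] -/
theorem kbar_kbar (hN : Even N) (k : Fin N) : kbar hN (kbar hN k) = k :=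
  Fin.ext (pairIdx_pairIdx k.val)

/-- The label of a vertex is its block edge or the partner. [cite: IkenmeyerKandasamy2019, §19] -/
theorem label_mem (hN : Even N) (pat : Finset (Fin 2 × Fin D)) (v : Fin N × Fin D) :
    label hN pat v = v.1 ∨ label hN pat v = kbar hN v.1 := by
  simp only [label, kbar, Fin.ext_iff, pairIdx_eq]
  split_ifs <;> omega

/-- The vertex of the pair of `κ` at position `(ε, s)`. [cite: IkenmeyerKandasamy2019, §19] -/
def vtx (hN : Even N) (κ : Fin N) (x : Fin 2 × Fin D) : Fin N × Fin D :=
  (⟨2 * (κ.val / 2) + x.1.val, by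
    have := two_mul_div_add_one_lt hN κ.isLt
    have := x.1.isLt
    omega⟩, x.2)

/-- [cite: IkenmeyerKandasamy2019, §19] -/
theorem vtx_injective (hN : Even N) (κ : Fin N) : Function.Injective (vtx (D := D) hN κ) := by
  intro x y h
  have h1 := congrArg (fun v : Fin N × Fin D => v.1.val) h
  have h2 := congrArg Prod.snd h
  simp only [vtx] at h1 h2
  exact Prod.ext (Fin.ext (by omega)) h2

/-- The position of the vertex at position `x` is `x`. [cite: IkenmeyerKandasamy2019, §19] -/
theorem pos_vtx (hN : Even N) (κ : Fin N) (x : Fin 2 × Fin D) :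
    (par (vtx hN κ x).1, (vtx hN κ x).2) = x := by
  have hx := x.1.isLt
  exact Prod.ext (Fin.ext (by simp only [vtx, par]; omega)) rfl

/-- The label of the vertex at position `x` of the pair of `κ`. [cite: IkenmeyerKandasamy2019, §19] -/
theorem label_vtx (hN : Even N) (pat : Finset (Fin 2 × Fin D)) (κ : Fin N) (x : Fin 2 × Fin D) :
    (label hN pat (vtx hN κ x)).val = 2 * (κ.val / 2) + (if x ∈ pat then 1 else 0) := by
  have hx := x.1.isLt
  have hdiv : (vtx hN κ x).1.val / 2 = κ.val / 2 := by
    simp only [vtx]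
    omega
  show 2 * ((vtx hN κ x).1.val / 2) +
    (if (par (vtx hN κ x).1, (vtx hN κ x).2) ∈ pat then 1 else 0) = _
  rw [hdiv, pos_vtx]

/-- Every vertex is the vertex at its own position of its own pair.
[cite: IkenmeyerKandasamy2019, §19] -/
theorem vtx_pos (hN : Even N) (v : Fin N × Fin D) : vtx hN v.1 (par v.1, v.2) = v := by
  obtain ⟨k, s⟩ := v
  refine Prod.ext (Fin.ext ?_) rfl
  simp only [vtx, par]
  omega

/-- The vertex at position `x` of the pair of `κ` lies in the block edge `κ` or in `κ̄`.
[cite: IkenmeyerKandasamy2019, §19] -/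
theorem fst_vtx (hN : Even N) (κ : Fin N) (x : Fin 2 × Fin D) :
    (vtx hN κ x).1 = κ ∨ (vtx hN κ x).1 = kbar hN κ := by
  have hx := x.1.isLt
  simp only [vtx, kbar, Fin.ext_iff, pairIdx_eq]
  omega

/-- **`|barred(i,j,k)| = D`, label form**: every label is carried by exactly `D` vertices — the
pattern (for the barred member) or its complement (for the unbarred member) of the pair.
[cite: IkenmeyerKandasamy2019, §19] -/
theorem card_label (hN : Even N) {pat : Finset (Fin 2 × Fin D)} (hpat : pat.card = D) (κ : Fin N) :
    (univ.filter fun v => label hN pat v = κ).card = D := by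
  classical
  have hset : (univ.filter fun v => label hN pat v = κ) =
      (if κ.val % 2 = 1 then pat else patᶜ).map ⟨vtx hN κ, vtx_injective hN κ⟩ := by
    ext v
    simp only [Finset.mem_filter, Finset.mem_univ, true_and, Finset.mem_map,
      Function.Embedding.coeFn_mk]
    constructor
    · intro h
      refine ⟨(par v.1, v.2), ?_, ?_⟩
      · have hv := congrArg Fin.val h
        have hv' : 2 * (v.1.val / 2) + (if (par v.1, v.2) ∈ pat then 1 else 0) = κ.val := hv
        by_cases hκ : κ.val % 2 = 1
        · rw [if_pos hκ]
          by_contra hns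
          rw [if_neg hns] at hv'
          omega
        · rw [if_neg hκ, Finset.mem_compl]
          intro hs
          rw [if_pos hs] at hv'
          omega
      · have hv := congrArg Fin.val h
        have hv' : 2 * (v.1.val / 2) + (if (par v.1, v.2) ∈ pat then 1 else 0) = κ.val := hv
        have hq : v.1.val / 2 = κ.val / 2 := by split_ifs at hv' <;> omega
        refine Prod.ext (Fin.ext ?_) rfl
        show 2 * (κ.val / 2) + v.1.val % 2 = v.1.val
        omega
    · rintro ⟨x, hx, rfl⟩
      apply Fin.ext
      rw [label_vtx]
      by_cases hκ : κ.val % 2 = 1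
      · rw [if_pos hκ] at hx
        rw [if_pos hx]
        omega
      · rw [if_neg hκ, Finset.mem_compl] at hx
        rw [if_neg hx]
        omega
  rw [hset, Finset.card_map]
  split_ifs
  · exact hpat
  · rw [Finset.card_compl, Fintype.card_prod, Fintype.card_fin, Fintype.card_fin, hpat]
    omega

/-- **Distinct patterns give different labels somewhere on every pair.**
[cite: IkenmeyerKandasamy2019, §19] -/
theorem label_ne (hN : Even N) {pat pat' : Finset (Fin 2 × Fin D)} (hne : pat ≠ pat') (κ : Fin N) :
    ∃ v : Fin N × Fin D, (v.1 = κ ∨ v.1 = kbar hN κ) ∧ label hN pat v ≠ label hN pat' v := by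
  classical
  obtain ⟨x, hx⟩ : ∃ x, ¬ (x ∈ pat ↔ x ∈ pat') := by
    by_contra h
    simp only [not_exists, not_not] at h
    exact hne (Finset.ext h)
  refine ⟨vtx hN κ x, fst_vtx hN κ x, fun h => hx ?_⟩
  have hv := congrArg Fin.val h
  rw [label_vtx, label_vtx] at hv
  by_cases h1 : x ∈ pat <;> by_cases h2 : x ∈ pat' <;> simp_all

/-- The bridge vertex lies in its block edge. [cite: IkenmeyerKandasamy2019, Def. 18.1] -/
theorem fst_brg (hD : 1 ≤ D) (k : Fin N) : (brg hD k).1 = k := rfl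

/-- The position of the bridge vertex of `k` in its pair: `(0, D-1)` or `(1, 0)`.
[cite: IkenmeyerKandasamy2019, §19] -/
theorem pos_brg (hD : 1 ≤ D) (k : Fin N) :
    (par (brg hD k).1, (brg hD k).2) =
      if k.val % 2 = 0 then ((0 : Fin 2), (⟨D - 1, by omega⟩ : Fin D))
      else ((1 : Fin 2), (⟨0, by omega⟩ : Fin D)) := by
  unfold brg par
  by_cases hk : k.val % 2 = 0
  · rw [if_pos hk, if_pos hk]
    exact Prod.ext (Fin.ext (by simp [hk])) rfl
  · rw [if_neg hk, if_neg hk]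
    exact Prod.ext (Fin.ext (by simp; omega)) rfl

/-- **The bridge vertices are labelled by their own block edge in every row** (the pattern
contains the position `(1, 0)` of the bridge of the barred member and avoids the position
`(0, D-1)` of the bridge of the unbarred member). [cite: IkenmeyerKandasamy2019, §19] -/
theorem label_brg (hN : Even N) (hD : 1 ≤ D) {pat : Finset (Fin 2 × Fin D)}
    (h₁ : ((1, ⟨0, by omega⟩) : Fin 2 × Fin D) ∈ pat)
    (h₀ : ((0, ⟨D - 1, by omega⟩) : Fin 2 × Fin D) ∉ pat) (k : Fin N) :
    label hN pat (brg hD k) = k := by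
  apply Fin.ext
  show 2 * ((brg hD k).1.val / 2) + (if (par (brg hD k).1, (brg hD k).2) ∈ pat then 1 else 0) = k.val
  rw [pos_brg]
  have hk1 : (brg hD k).1 = k := rfl
  rw [hk1]
  by_cases hk : k.val % 2 = 0
  · rw [if_pos hk, if_neg h₀]
    omega
  · rw [if_neg hk, if_pos h₁]
    omega

/-- Both bridge vertices of the pair `{k, k̄}` lie in the size-2 name edge `Chain.bridge` between the
block edges `2(k/2)` and `2(k/2)+1`. [cite: IkenmeyerKandasamy2019, Prop. 18.3] -/
theorem brg_mem_bridge (hD : 1 ≤ D) (k : Fin N) (j : Fin N) (hj : j.val = 2 * (k.val / 2)) :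
    brg hD k ∈ Chain.bridge D N j := by
  simp only [Chain.bridge, Finset.mem_filter, Finset.mem_univ, true_and]
  by_cases hk : k.val % 2 = 0
  · have hb : brg hD k = (k, ⟨D - 1, by omega⟩) := by simp [brg, hk]
    rw [hb]
    left
    exact ⟨Fin.ext (by show k.val = j.val; omega), by show D - 1 + 1 = D; omega⟩
  · have hb : brg hD k = (k, ⟨0, by omega⟩) := by simp [brg, hk]
    rw [hb]
    right
    exact ⟨by show k.val = j.val + 1; omega, rfl⟩

/-- The link vertex `(0,0)` is not a bridge vertex (§21: "Note that `ζ^{(i)}` is not a bridge vertex").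
[cite: IkenmeyerKandasamy2019, §21] -/
theorem brg_ne_origin (hD : 2 ≤ D) (k : Fin N) (v : Fin N × Fin D) (hv1 : v.1.val = 0)
    (hv2 : v.2.val = 0) : v ≠ brg (by omega) k := by
  intro h
  have h1 := congrArg (fun w : Fin N × Fin D => w.1.val) h
  have h2 := congrArg (fun w : Fin N × Fin D => w.2.val) h
  simp only [brg] at h1 h2
  split_ifs at h2 with hk
  · simp only at h2
    omega
  · simp only at h2
    omega

end OddChain

/-! ## §C  The hypergraph data for odd `D` -/

/-- E4's `exists_linkFun_chain` with one more conclusion recorded: `ℓ` is constant on every name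
edge (by construction `ℓ(v)` is the index of the name edge of `v`, §19 TeX L3020–3025).
[cite: IkenmeyerKandasamy2019, §19] -/
theorem exists_linkFun_chain₂ {D b L₁ L₂ K : ℕ} {ζ : Fin b × Fin D}
    (hH : (Chain.hyper D b L₁ L₂).IsDK D K ζ) :
    ∃ (ℓ : Fin b × Fin D → Fin (b + K)) (ξ : Fin b × Fin D),
      (∀ a, 1 ≤ (univ.filter fun v => ℓ v = a).card ∧ (univ.filter fun v => ℓ v = a).card < D) ∧
      (∀ v w, Relation.ReflTransGen (fun v w : Fin b × Fin D => v.1 = w.1 ∨ ℓ v = ℓ w) v w) ∧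
      (ζ ≠ ξ ∧ ζ.1 = ξ.1 ∧ ℓ ζ = ℓ ξ) ∧
      ∀ E ∈ (Chain.hyper D b L₁ L₂).names, ∀ v ∈ E, ∀ w ∈ E, ℓ v = ℓ w := by
  classical
  set H := Chain.hyper D b L₁ L₂ with hHdef
  have hD : 0 < D := lt_of_lt_of_le (by norm_num) hH.two_le
  have hmemB : ∀ E ∈ H.blocks, ∀ v ∈ E, ∀ w ∈ E, v.1 = w.1 := by
    intro E hE v hv w hw
    have hE' : E ∈ Finset.univ.image (Chain.row D b) := hE
    obtain ⟨j, -, rfl⟩ := Finset.mem_image.mp hE'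
    simp only [Chain.row, Finset.mem_filter, Finset.mem_univ, true_and] at hv hw
    rw [hv, hw]
  have hcardB : H.blocks.card = b := by
    have h := hH.card_eq
    rw [Fintype.card_prod, Fintype.card_fin, Fintype.card_fin] at h
    exact (Nat.eq_of_mul_eq_mul_right hD (by rw [h, mul_comm])).symm
  have hcardN : Fintype.card ↥H.names = b + K := by
    rw [Fintype.card_coe, hH.card_names, hcardB]
  let e : ↥H.names ≃ Fin (b + K) := Fintype.equivFinOfCardEq hcardN
  have np := hH.names_partition
  let ℓ : Fin b × Fin D → Fin (b + K) := fun v => e ⟨np.part v, np.part_mem v⟩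
  have hℓeq : ∀ v w, ℓ v = ℓ w ↔ np.part v = np.part w := by
    intro v w
    simp only [ℓ, e.apply_eq_iff_eq, Subtype.mk.injEq]
  have hfib : ∀ a, (univ.filter fun v => ℓ v = a) = (e.symm a).1 := by
    intro a
    ext v
    simp only [Finset.mem_filter, Finset.mem_univ, true_and, ℓ]
    rw [Equiv.apply_eq_iff_eq_symm_apply]
    constructor
    · intro h
      rw [← h]
      exact np.mem_part v
    · intro h
      apply Subtype.ext
      exact (np.eq_part (e.symm a).2 h).symm
  have hnames : ∀ E ∈ H.names, ∀ v ∈ E, ∀ w ∈ E, ℓ v = ℓ w := fun E hE v hv w hw =>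
    (hℓeq v w).2 (by rw [← np.eq_part hE hv, ← np.eq_part hE hw])
  obtain ⟨eN, heN, eB, heB, hζN, hζB, h2⟩ := hH.link_mem
  obtain ⟨ξ, hξ, hne⟩ := Finset.exists_mem_ne (lt_of_lt_of_le one_lt_two h2) ζ
  rw [Finset.mem_inter] at hξ
  refine ⟨ℓ, ξ, fun a => ?_, fun v w => ?_,
    ⟨hne.symm, hmemB eB heB ζ hζB ξ hξ.2, hnames eN heN ζ hζN ξ hξ.1⟩, hnames⟩
  · rw [hfib a]
    exact hH.card_name _ (e.symm a).2
  · have hstep : ∀ v w : Fin b × Fin D, H.Adj v w → v.1 = w.1 ∨ ℓ v = ℓ w := by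
      rintro v w ⟨E, hE, hv, hw⟩
      unfold Hypergraph.edges at hE
      rcases Finset.mem_union.mp hE with hB | hN
      · exact Or.inl (hmemB E hB v hv w hw)
      · exact Or.inr (hnames E hN v hv w hw)
    exact Relation.ReflTransGen.mono hstep v w (hH.connected v w)

/-- The size-2 name edges `{(j, D-1), (j+1, 0)}` of the chain are name edges.
[cite: IkenmeyerKandasamy2019, Prop. 18.3] -/
theorem bridge_mem_names {D b L₁ L₂ : ℕ} (j : Fin b) (hj : j.val + 1 < b) :
    Chain.bridge D b j ∈ (Chain.hyper D b L₁ L₂).names := by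
  show Chain.bridge D b j ∈ Chain.names D b L₁ L₂
  unfold Chain.names Chain.bridges
  exact Finset.mem_union_left _ (Finset.mem_image.mpr ⟨j, by simpa using hj, rfl⟩)

/-- **The data of `H^{(i)}` for one letter, odd `D`** (`K = ϱ_i ≠ 0`; an even number `b` of block
edges with `K ≤ b(D-2) ≤ K + 2(D-2) - 1`, e.g. `b = 2⌈K/(2(D-2))⌉`): the paired chain of the proof
of Prop. 18.3 (`IK2020.Chain.isDK_hyper` with the surplus vertices in at most two name edges, as in
`IK2020_prop_18_3_holds`) gives the name-edge index, the link pair, and a link vertex `(0,0)`;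
the bridges `(2p, D-1) ~ (2p+1, 0)` share a name edge. [cite: IkenmeyerKandasamy2019, Prop. 18.3] -/
theorem exists_oddLinkFun {D K b : ℕ} (hD : 3 ≤ D) (hK : K ≠ 0) (hbev : Even b)
    (hlo : K ≤ b * (D - 2)) (hhi : b * (D - 2) + 5 ≤ K + 2 * D) :
    ∃ (ℓ : Fin b × Fin D → Fin (b + K)) (ζ ξ : Fin b × Fin D),
      (∀ a, 1 ≤ (univ.filter fun v => ℓ v = a).card ∧ (univ.filter fun v => ℓ v = a).card < D) ∧
      (∀ v w, Relation.ReflTransGen (fun v w : Fin b × Fin D => v.1 = w.1 ∨ ℓ v = ℓ w) v w) ∧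
      (ζ ≠ ξ ∧ ζ.1 = ξ.1 ∧ ℓ ζ = ℓ ξ) ∧ (ζ.1.val = 0 ∧ ζ.2.val = 0) ∧
      ∀ k : Fin b, ℓ (OddChain.brg (by omega) k) = ℓ (OddChain.brg (by omega) (OddChain.kbar hbev k)) := by
  have hb : 1 ≤ b := by
    rcases Nat.eq_zero_or_pos b with rfl | h
    · rw [zero_mul] at hlo
      omega
    · exact h
  have hb2 : 2 ≤ b := by obtain ⟨t, rfl⟩ := hbev; omega
  set L := b * (D - 2) + 2 - K with hL_def
  have hL2 : 2 ≤ L := by rw [hL_def]; generalize b * (D - 2) = M at hlo hhi ⊢; omega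
  have hLD : L ≤ 2 * D - 3 := by rw [hL_def]; generalize b * (D - 2) = M at hlo hhi ⊢; omega
  have hKL : K + L + 1 = b * (D - 2) + 3 := by
    rw [hL_def]; generalize b * (D - 2) = M at hlo hhi ⊢; omega
  have h1 : 2 ≤ min L (D - 1) := le_min hL2 (by omega)
  have h2 : min L (D - 1) + 1 ≤ D := Nat.succ_le_of_lt (lt_of_le_of_lt (min_le_right _ _) (by omega))
  have h3 : 1 ≤ L + 1 - min L (D - 1) := by have := min_le_left L (D - 1); omega
  have h4 : L + 1 - min L (D - 1) + 1 ≤ D := by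
    rcases Nat.le_total L (D - 1) with h | h
    · rw [min_eq_left h]; omega
    · rw [min_eq_right h]; omega
  have h5 : K + min L (D - 1) + (L + 1 - min L (D - 1)) = b * (D - 2) + 3 := by
    rcases Nat.le_total L (D - 1) with h | h
    · rw [min_eq_left h]; omega
    · rw [min_eq_right h]; omega
  have hH := Chain.isDK_hyper (L₁ := min L (D - 1)) (L₂ := L + 1 - min L (D - 1)) hb hD h1 h2 h3
    h4 (fun h => by omega) h5
  obtain ⟨ℓ, ξ, hfib, hconn, hlink, hnames⟩ := exists_linkFun_chain₂ hH
  refine ⟨ℓ, _, ξ, hfib, hconn, hlink, ⟨rfl, rfl⟩, fun k => ?_⟩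
  have hj : 2 * (k.val / 2) + 1 < b := OddChain.two_mul_div_add_one_lt hbev k.isLt
  have hk' : 2 * ((OddChain.kbar hbev k).val / 2) = 2 * (k.val / 2) := by
    simp only [OddChain.kbar, OddChain.pairIdx_eq]
    omega
  exact hnames _ (bridge_mem_names ⟨2 * (k.val / 2), by omega⟩ hj) _
    (OddChain.brg_mem_bridge (by omega) k _ rfl) _
    (OddChain.brg_mem_bridge (by omega) (OddChain.kbar hbev k) _ hk'.symm)

/-- For odd `D` every letter has an even number of block edges, `n_i = 2⌈ϱ_i/(2(D-2))⌉`.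
[cite: IkenmeyerKandasamy2019, Prop. 18.3] -/
theorem even_blockCount {D : ℕ} (hDo : Odd D) (r : ℕ) : Even (blockCount D r) := by
  rw [blockCount_of_odd hDo]
  exact even_two_mul _

/-- **"For each `i ∈ I` let `H^{(i)}` be the `(D, ϱ_i)`-paired-hypergraph from Proposition 18.3"**
(§19, TeX L2994–2996) with the bridges, the `barred` sets and "Let `h` denote the smallest number in
`I`": for odd `D ≥ 3`, `m ≤ C(2D-2, D-1)` and any `h ∈ I` the data
`IK2020.OddLinkData m D (blockCount D ∘ ϱ) ϱ` exists. [cite: IkenmeyerKandasamy2019, §19] -/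
theorem nonempty_oddLinkData {m D : ℕ} (hD : 3 ≤ D) (hDo : Odd D)
    (hm : m ≤ Nat.choose (2 * D - 2) (D - 1)) (ρ : Fin m → ℕ) (h₀ : Fin m) (hh₀ : ρ h₀ ≠ 0) :
    Nonempty (OddLinkData m D (fun i => blockCount D (ρ i)) ρ) := by
  classical
  obtain ⟨pat, hinj, hpat⟩ := exists_patterns (D := D) (by omega) hm
  have hc : 1 ≤ 2 * (D - 2) := by omega
  have hev : ∀ i, Even (blockCount D (ρ i)) := fun i => even_blockCount hDo (ρ i)
  have H : ∀ i : Fin m, ρ i ≠ 0 →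
      ∃ (ℓ : Fin (blockCount D (ρ i)) × Fin D → Fin (blockCount D (ρ i) + ρ i))
        (ζ ξ : Fin (blockCount D (ρ i)) × Fin D),
        (∀ a, 1 ≤ (univ.filter fun v => ℓ v = a).card ∧ (univ.filter fun v => ℓ v = a).card < D) ∧
        (∀ v w, Relation.ReflTransGen
          (fun v w : Fin (blockCount D (ρ i)) × Fin D => v.1 = w.1 ∨ ℓ v = ℓ w) v w) ∧
        (ζ ≠ ξ ∧ ζ.1 = ξ.1 ∧ ℓ ζ = ℓ ξ) ∧ (ζ.1.val = 0 ∧ ζ.2.val = 0) ∧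
        ∀ k, ℓ (OddChain.brg (by omega) k) = ℓ (OddChain.brg (by omega) (OddChain.kbar (hev i) k)) := by
    intro i hi
    obtain ⟨hlo, hhi⟩ := ceilDiv_mul_ge_and_le (ρ i) (2 * (D - 2)) hc
    have hb : blockCount D (ρ i) * (D - 2) = ceilDiv (ρ i) (2 * (D - 2)) * (2 * (D - 2)) := by
      rw [blockCount_of_odd hDo]; ring
    refine exists_oddLinkFun hD hi (hev i) ?_ ?_
    · rw [hb]; exact hlo
    · rw [hb]; omega
  choose ℓ ζ ξ hℓ using H
  have hzero : ∀ i, ρ i = 0 → blockCount D (ρ i) = 0 := fun i hi => by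
    rw [hi, blockCount_zero]
  have hempty : ∀ i, ρ i = 0 → ∀ v : Fin (blockCount D (ρ i)) × Fin D, False := by
    intro i hi v
    have h : (v.1 : ℕ) < blockCount D (ρ i) := v.1.isLt
    have h0 := hzero i hi
    omega
  have hemptyA : ∀ i, ρ i = 0 → ∀ a : Fin (blockCount D (ρ i) + ρ i), False := by
    intro i hi a
    have h : (a : ℕ) < blockCount D (ρ i) + ρ i := a.isLt
    have h0 := hzero i hi
    omega
  have hemptyK : ∀ i, ρ i = 0 → ∀ k : Fin (blockCount D (ρ i)), False := by
    intro i hi k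
    have h : (k : ℕ) < blockCount D (ρ i) := k.isLt
    have h0 := hzero i hi
    omega
  refine ⟨{
    ℓ := fun i => if hi : ρ i ≠ 0 then ℓ i hi else fun v => Fin.castAdd (ρ i) v.1
    ζ := ζ
    ξ := ξ
    n_eq_zero := hzero
    one_le_card := fun i a => ?_
    card_lt := fun i a => ?_
    conn := fun i v w => ?_
    ζ_ne_ξ := fun i hi => (hℓ i hi).2.2.1.1
    fst_ζ := fun i hi => (hℓ i hi).2.2.1.2.1
    ℓ_ζ := fun i hi => ?_
    h₀ := h₀
    ρ_h₀ := hh₀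
    kbar := fun i => OddChain.kbar (hev i)
    kbar_ne := fun i k => OddChain.kbar_ne (hev i) k
    kbar_kbar := fun i k => OddChain.kbar_kbar (hev i) k
    β := fun i j => OddChain.label (hev i) (pat j)
    β_mem := fun i j v => OddChain.label_mem (hev i) (pat j) v
    card_β := fun i j k => OddChain.card_label (hev i) (hpat j).1 k
    β_ne := fun i j j' _ _ hjj' k => OddChain.label_ne (hev i) (fun h => hjj' (hinj h)) k
    br := fun i => OddChain.brg (by omega)
    fst_br := fun i k => rfl
    β_br := fun i j k => OddChain.label_brg (hev i) (by omega) (hpat j).2.1 (hpat j).2.2 k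
    ℓ_br := fun i k => ?_
    ζ_ne_br := fun i hi k => ?_ }⟩
  · by_cases hi : ρ i ≠ 0
    · simp only [dif_pos hi]
      exact ((hℓ i hi).1 a).1
    · exact (hemptyA i (not_not.mp hi) a).elim
  · by_cases hi : ρ i ≠ 0
    · simp only [dif_pos hi]
      exact ((hℓ i hi).1 a).2
    · exact (hemptyA i (not_not.mp hi) a).elim
  · by_cases hi : ρ i ≠ 0
    · simp only [dif_pos hi]
      exact (hℓ i hi).2.1 v w
    · exact (hempty i (not_not.mp hi) v).elim
  · simp only [dif_pos hi]
    exact (hℓ i hi).2.2.1.2.2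
  · by_cases hi : ρ i ≠ 0
    · simp only [dif_pos hi]
      exact (hℓ i hi).2.2.2.2 k
    · exact (hemptyK i (not_not.mp hi) k).elim
  · exact OddChain.brg_ne_origin (by omega) k (ζ i hi) (hℓ i hi).2.2.2.1.1 (hℓ i hi).2.2.2.1.2

/-! ## §D  Assembly; Thm. 13.1 for odd `D`; the discharge -/

namespace OddLinkData

variable {m D : ℕ} {n ρ : Fin m → ℕ} (X : OddLinkData m D n ρ)

/-- The content of `leftpart(T)` does not depend on the enumeration of its columns.
[cite: IkenmeyerKandasamy2019, §19] -/
theorem count_rectTableau_oleftpart {E : ℕ} (ε : Fin E ≃ LCol m D n) (u : LiftSym m n ρ) :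
    (rectTableau fun c r => X.oleftpart (ε c) r).count u =
      ∑ c, (univ.filter fun r => X.oleftpart c r = u).card := by
  rw [count_rectTableau]
  exact Equiv.sum_comp ε (fun c => (univ.filter fun r => X.oleftpart c r = u).card)

/-- Reindexing a finite filter along a bijection. [folklore] -/
private theorem card_filter_comp_equiv' {α β : Type*} [Fintype α] [Fintype β] (e : α ≃ β)
    (P : β → Prop) [DecidablePred P] :
    (univ.filter fun a => P (e a)).card = (univ.filter P).card := by
  have h : (univ.filter fun a => P (e a)) = (univ.filter P).map e.symm.toEmbedding := by
    ext a
    simp only [Finset.mem_filter, Finset.mem_univ, true_and, Finset.mem_map_equiv,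
      Equiv.symm_symm]
  rw [h, Finset.card_map]

/-- **The lifted tableau is a lifting witness, odd `D`** (§21, TeX L3290–3560): with
`leftpart(T) = B̌` and `rightpart(T)` chosen with the quotas `D - n(i_ℓ)` of §20 (Claim 42 =
Claim 26), every symbol occurs exactly `D` times (Claims 41, 42, 44); for every `φ` with `φ(T)`
regular, `rightpart(φ(T)) ∈ 𝔖_m S` (Claims 46, 47) and `leftpart(φ(T))` is duplex ((I)–(III) on
paired block edges); and `φ(i_ℓ) = i`, `φ(j_k^i) = φ(j_k̄^i) = j` makes `φ(T)` regular with
`rightpart(φ(T)) = S`. [cite: IkenmeyerKandasamy2019, Thm. 13.1] -/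
theorem exists_liftingWitness (S : ColTableau (Fin m)) (hreg : S.IsRegular)
    (hcnt : ∀ i, S.count i = D * ρ i) {E : ℕ} (ε : Fin E ≃ LCol m D n) :
    ∃ R : (c : Fin S.C) → Fin (S.h c) → LiftSym m n ρ,
      LiftingWitness D S (fun c r => X.oleftpart (ε c) r) R := by
  classical
  obtain ⟨R, hR1, hR2, hR3⟩ := exists_rightpart S
    (fun x : (Σ i : Fin m, Fin (n i + ρ i)) => D - (univ.filter fun v => X.ℓ x.1 v = x.2).card)
    (fun i => by rw [X.sum_sub_card_fibre, hcnt])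
  refine ⟨R, fun u => ?_, fun φ hL hRφ => ?_, ?_⟩
  · rw [X.count_rectTableau_oleftpart ε]
    rcases LiftSym.eq_name_or_eq_block u with ⟨i, a, rfl⟩ | ⟨i, k, j, hj, rfl⟩
    · rw [X.lcount_name, hR2]
      exact Nat.add_sub_cancel' (X.card_lt i a).le
    · rw [X.lcount_block, show (ColTableau.mk S.C S.h R).count (LiftSym.block i k j hj) = 0
        from hR3 _, Nat.add_zero]
  · have hreg' : ∀ c, Function.Injective fun r => φ (X.oleftpart c r) := fun c => by
      have h := hL (ε.symm c)
      simp only [rectTableau, Equiv.apply_symm_apply] at h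
      exact h
    refine ⟨exists_perm_relabel_eq_of_name_const' S hR1 hcnt φ (X.phi0 φ) (X.phi_name hreg')
      (X.phi0_injOn hreg'), ?_⟩
    rw [isDuplex_rectTableau_iff]
    intro c
    have h := X.even_card_filter_leftpart hreg' (ε c)
    rw [← card_filter_comp_equiv' ε] at h
    convert h using 2
  · exact ⟨LiftSym.base, fun c => X.injective_base_leftpart (ε c),
      isRegular_relabel_base S hR1 hreg, relabel_base_eq S hR1⟩

end OddLinkData

end IK2020

open IK2020

/-- **Ikenmeyer–Kandasamy 2020, Thm. 13.1 (Tableau Lifting Theorem) for odd `D`**, over the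
descriptive alphabet `i_ℓ`, `j_k^i`, `j_k̄^i` of §13 (`IK2020.LiftSym` with `n_i = 2⌈ϱ_i/(2(D-2))⌉`):
for odd `D ≥ 3`, `m ≥ 2` with `C(2(D-1), D-1) ≥ 2(m-1)`, a regular tableau `S` of shape
`λ ⊢_m dD` and content `Dϱ`, there is a lifted tableau with `e_ϱ D` left columns in which every
symbol occurs exactly `D` times and with properties (1), (2), (3) (`IK2020.LiftingWitness`). Proof
= §§18–21 as formalised in bricks O1 (`leftpart`, Claims 39–53), E3 (`rightpart`), §§A–C above
(the data from the paired chains of Prop. 18.3 and the `barred` patterns), and the corner `d = 0`.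
[cite: IkenmeyerKandasamy2019, Thm. 13.1] -/
theorem IK2020_thm_13_1_odd (D m d : ℕ) (hDo : Odd D) (hD : 3 ≤ D) (hm : 2 ≤ m)
    (hbin : 2 * (m - 1) ≤ Nat.choose (2 * (D - 1)) (D - 1))
    (S : ColTableau (Fin m)) (hS : S.IsShape m (d * D)) (hreg : S.IsRegular)
    (ρ : Fin m → ℕ) (hsum : ∑ i, ρ i = d) (hcnt : ∀ i, S.count i = D * ρ i) :
    ∃ (L : Fin (eRho D (Finset.univ.val.map ρ) * D) → Fin m →
        LiftSym m (fun i => blockCount D (ρ i)) ρ)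
      (R : (c : Fin S.C) → Fin (S.h c) → LiftSym m (fun i => blockCount D (ρ i)) ρ),
      LiftingWitness D S L R := by
  classical
  by_cases hd : d = 0
  · subst hd
    have hρ : ∀ i, ρ i = 0 := fun i => by
      have := Finset.single_le_sum (fun j _ => Nat.zero_le (ρ j)) (Finset.mem_univ i)
      omega
    have he : eRho D (Finset.univ.val.map ρ) = 0 := by
      rw [eRho_map_eq_sum]
      exact Finset.sum_eq_zero fun i _ => by rw [hρ i, blockCount_zero]
    have hC : S.C = 0 := ColTableau.C_eq_zero_of_isShape_zero (by simpa using hS)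
    have hE : eRho D (Finset.univ.val.map ρ) * D = 0 := by rw [he, zero_mul]
    haveI : IsEmpty (LiftSym m (fun i => blockCount D (ρ i)) ρ) := by
      rw [← Fintype.card_eq_zero_iff, card_liftSym_blockCount D ρ hsum, he, mul_zero]
    exact ⟨fun c => (Fin.cast hE c).elim0, fun c => (Fin.cast hC c).elim0,
      LiftingWitness.of_isEmpty (by omega) hC _ _⟩
  · obtain ⟨h₀, hh₀⟩ : ∃ i, ρ i ≠ 0 := by
      by_contra h
      simp only [not_exists, not_not] at h
      exact hd (by rw [← hsum]; exact Finset.sum_eq_zero fun i _ => h i)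
    have hm' : m ≤ Nat.choose (2 * D - 2) (D - 1) := by
      have h2 : 2 * (D - 1) = 2 * D - 2 := by omega
      rw [h2] at hbin
      omega
    obtain ⟨X⟩ := nonempty_oddLinkData hD hDo hm' ρ h₀ hh₀
    let ε : Fin (eRho D (Finset.univ.val.map ρ) * D) ≃ LCol m D (fun i => blockCount D (ρ i)) :=
      (Fintype.equivFinOfCardEq (card_lCol_blockCount D ρ)).symm
    obtain ⟨R, hW⟩ := X.exists_liftingWitness S hreg hcnt ε
    exact ⟨_, R, hW⟩

/-- **DISCHARGE of the named fact `IK2020_thm_13_1`** (Ikenmeyer–Kandasamy 2020, Thm. 13.1, the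
Tableau Lifting Theorem, TeX L1128–1144): by parity of `D`, from `IK2020_thm_13_1_even` (brick E4)
and `IK2020_thm_13_1_odd`, through E4's `IK2020_thm_13_1_of_odd_case` (transport from the
descriptive alphabet to `{1, …, δ}`, `δ = m e_ϱ + d`, §13). [cite: IkenmeyerKandasamy2019, Thm. 13.1] -/
theorem IK2020_thm_13_1_holds : IK2020_thm_13_1 :=
  IK2020_thm_13_1_of_odd_case fun D m d hDo hD hm hbin S hS hreg ρ _ hsum hcnt =>
    IK2020_thm_13_1_odd D m d hDo hD hm hbin S hS hreg ρ hsum hcnt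

end Literature.Computability.AlgebraicComplexity
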